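import Literature.NumberTheory.EllipticCurves.Voight2007.RingClassGenusFieldHolds
import HarnessLib

/-!
# Genus theory of the Hilbert class field at the prime `2`: **`√(2u) ∉ K[1]`** (`u` odd square-free) for an
# imaginary quadratic `K` with `d_K/4` odd — in particular `√2, √14 ∉ K[1]` (Cox, *Primes of the form
# x² + ny²*, Thm. 6.1; Voight 2007, Prop. 3.8 / Cor. 3.9)

Topic `NumberTheory/EllipticCurves` (ring class fields realised in `ℂ`: `ringClassField K ι n = K[n]` of
`HeegnerPointsOfConductor.lean`; `K[1]` is the Hilbert class field). THEOREMS only (no definition, no named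
fact); everything is PROVED from the tree's proved Voight 2007 Prop. 3.8
(`Voight2007.prop38_sqrt_mem_ringClassField_iff_holds`: for a fundamental discriminant `m` and
`n = disc ℚ(√(d_K m))`, `d_K m = n s²`, one has `(∃ r ∈ K[f], r² = m) ↔ m n ∣ d_K f²`).

* `not_isSquare_two_mul_ringClassField_one` — for `K` imaginary quadratic with `Odd (d_K / 4)` (i.e. `d_K`
  odd, or `d_K = 4e` with `e ≡ 3 (mod 4)`; the case `8 ∣ d_K` is exactly the excluded one) and `u` odd
  square-free: `2u` is not a square in `K[1]`. PROOF: `m = 8u` is the (fundamental) discriminant of `ℚ(√(2u))`;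
  writing `d_K = t² D₀` (`t ∈ {1, 2}`, `D₀` odd square-free), `g = gcd(u, D₀)`, `u = g u′`, `D₀ = g D′`, the
  field `ℚ(√(d_K m))` is `ℚ(√(2u′D′))` of discriminant `n = 8u′D′` and `d_K m = n (g t)²`; the criterion
  `m n = 64 g u′² D′ ∣ d_K = t² g D′` would force `64 u′² ∣ t² ≤ 4`. So `√(8u) ∉ K[1]`, i.e. `√(2u) ∉ K[1]`.
  (Classically: `2` has ramification index `e(2, K[1]/ℚ) = e(2, K/ℚ) ≤ 2`, `K[1]/K` being unramified,
  while `ℚ(√(2u), √(d_K))` is totally ramified of degree `4` at `2` when `8 ∤ d_K`.)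
* `not_isSquare_two_ringClassField_one`, `not_isSquare_fourteen_ringClassField_one` — the instances
  `u = 1`, `u = 7`: **exactly the two genus-field hypotheses `hsqrt2`, `hsqrt14`** of the cell `bsd-goldfeld`'s
  theorems `bsdp_two_negPrimeTwist_fiveModEight_symbolNeg_of_print` /
  `analyticRank_eq_one_negPrimeTwist_fiveModEight_symbolNeg_of_print` (Summits side), which are thereby
  discharged.

HONEST FRAMING: classical, published genus theory (Gauss/Cox Thm. 6.1: the genus field of `K` is
`K(√p₁*, …, √p_r*)` for the prime discriminants `pᵢ* ∣ d_K`; `8 ∤ d_K` means `±8` is not among them), proved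
here on top of the tree's proved class field theory of `K[f]`; no statement about elliptic curves or BSD.
Mathlib / tree search: `lean search 'sqrt.*ringClassField'` → the tree's `RingClassFieldGenusProofs`
(`sqrt_intCast_not_mem_ringClassField`: odd primes `ℓ ∤ d_K` only), `Voight2007.RingClassGenusFieldProofs`
(`sqrt_not_mem_ringClassField_of_emod_four_eq_two`: `d_K` odd only) — the case `4 ∥ d_K` was missing.

## References
* D. A. Cox, *Primes of the form x² + ny²*, 2nd ed. (2013), §6.A Thm. 6.1, §9.A. [Cox2013]
* J. Voight, *Quadratic forms that represent almost the same primes*, Math. Comp. 76 (2007), §3 Prop. 3.8,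
  Cor. 3.9. [Voight2007]
-/

noncomputable section

open NumberField

namespace Literature.NumberTheory.EllipticCurves

open Literature.NumberTheory.QuadraticFields.Quadratic

variable {K : Type} [Field K] [NumberField K]

/-- **`√(2u) ∉ K[1]` for `u` odd square-free when `d_K/4` is odd** (Cox Thm. 6.1 at the prime `2`, via
Voight Prop. 3.8 with `m = 8u`, `f = 1`: the criterion `m·disc ℚ(√(d_K m)) ∣ d_K` fails by a factor `64u′²/t²`,
see the module docstring). [cite: Cox2013, §6.A Thm. 6.1] [cite: Voight2007, §3 Prop. 3.8 and Cor. 3.9] -/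
theorem not_isSquare_two_mul_ringClassField_one (hK : IsImaginaryQuadratic K) (ι : K →+* ℂ)
    (hodd : Odd (NumberField.discr K / 4)) {u : ℤ} (hu : Odd u) (husq : Squarefree u) :
    ¬ IsSquare ((2 * u : ℤ) : ringClassField K ι 1) := by
  rintro ⟨r, hr⟩
  have hu0 : u ≠ 0 := husq.ne_zero
  -- `d_K = t² D₀` with `t ∈ {1, 2}` and `D₀` odd square-free
  obtain ⟨t, D₀, htD, ht, hD₀odd, hD₀sq⟩ : ∃ t D₀ : ℤ, NumberField.discr K = t ^ 2 * D₀ ∧ (t = 1 ∨ t = 2) ∧ Odd D₀ ∧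
      Squarefree D₀ := by
    rcases isFundamentalDiscriminant_discr (K := K) hK.finrank_eq_two with ⟨h1, hsq, -⟩ | ⟨⟨e, he⟩, -, hsq⟩
    · exact ⟨1, NumberField.discr K, by ring, Or.inl rfl, Int.odd_iff.mpr (by omega), hsq⟩
    · have he' : NumberField.discr K / 4 = e := by rw [he, Int.mul_ediv_cancel_left _ four_ne_zero]
      rw [he'] at hodd hsq
      exact ⟨2, e, by rw [he]; ring, Or.inr rfl, hodd, hsq⟩
  have hD₀0 : D₀ ≠ 0 := hD₀sq.ne_zero
  -- `g = gcd(u, D₀)`, `u = g u'`, `D₀ = g D'`, `gcd(u', D') = 1`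
  set g : ℤ := (Int.gcd u D₀ : ℤ) with hg
  have hgpos : 0 < Int.gcd u D₀ := Int.gcd_pos_of_ne_zero_left _ hu0
  have hg0 : g ≠ 0 := by rw [hg]; exact_mod_cast hgpos.ne'
  set u' : ℤ := u / g with hu'_def
  set D' : ℤ := D₀ / g with hD'_def
  have hu' : u = g * u' := (Int.mul_ediv_cancel' (Int.gcd_dvd_left u D₀)).symm
  have hD' : D₀ = g * D' := (Int.mul_ediv_cancel' (Int.gcd_dvd_right u D₀)).symm
  have hcop : IsCoprime u' D' := Int.isCoprime_iff_gcd_eq_one.mpr (Int.gcd_div_gcd_div_gcd hgpos)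
  have hu'odd : Odd u' := (Int.odd_mul.mp (hu' ▸ hu)).2
  have hD'odd : Odd D' := (Int.odd_mul.mp (hD' ▸ hD₀odd)).2
  have hu'sq : Squarefree u' := husq.squarefree_of_dvd ⟨g, by rw [mul_comm]; exact hu'⟩
  have hD'sq : Squarefree D' := hD₀sq.squarefree_of_dvd ⟨g, by rw [mul_comm]; exact hD'⟩
  have hu'0 : u' ≠ 0 := hu'sq.ne_zero
  have hD'0 : D' ≠ 0 := hD'sq.ne_zero
  -- `8w` is a fundamental discriminant for `w` odd square-free (`m = 8u`, `n = 8u'D'`)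
  have hfund : ∀ {w : ℤ}, Odd w → Squarefree w →
      ((8 * w) % 4 = 1 ∧ Squarefree (8 * w) ∧ 8 * w ≠ 1) ∨
        (4 ∣ 8 * w ∧ ((8 * w) / 4 % 4 = 2 ∨ (8 * w) / 4 % 4 = 3) ∧ Squarefree ((8 * w) / 4)) := fun {w} hw hwsq ↦ by
    have h84 : (8 * w) / 4 = 2 * w := by omega
    refine Or.inr ⟨⟨2 * w, by ring⟩, ?_, ?_⟩
    · rw [h84]; have := Int.odd_iff.mp hw; omega
    · rw [h84]
      obtain ⟨k, hk⟩ := hw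
      exact squarefree_mul_iff.mpr ⟨(show IsCoprime (2 : ℤ) w from ⟨-k, 1, by rw [hk]; ring⟩).isRelPrime,
        Int.prime_two.irreducible.squarefree, hwsq⟩
  have hn : Squarefree (u' * D') := squarefree_mul_iff.mpr ⟨hcop.isRelPrime, hu'sq, hD'sq⟩
  have hnodd : Odd (u' * D') := Int.odd_mul.mpr ⟨hu'odd, hD'odd⟩
  -- Voight Prop. 3.8 at `f = 1`, `m = 8u`, `n = 8u'D'`, `s = g t`
  have key := Voight2007.prop38_sqrt_mem_ringClassField_iff_holds K hK ι 1 one_ne_zero (8 * u) (8 * (u' * D')) (g * t)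
    (hfund hu husq) (Or.inl (hfund hnodd hn)) (by rw [htD, hD', hu']; ring)
  have hsq8 : ∃ r' : ringClassField K ι 1, r' ^ 2 = ((8 * u : ℤ) : ringClassField K ι 1) :=
    ⟨2 * r, by rw [mul_pow, sq r, ← hr]; push_cast; ring⟩
  have hdvd := key.mp hsq8
  -- `64 g u'² D' ∣ t² g D'`: impossible
  rw [htD, hD', hu', Nat.cast_one, one_pow, mul_one, show 8 * (g * u') * (8 * (u' * D')) = 64 * u' ^ 2 * (g * D') by ring,
    show t ^ 2 * (g * D') = t ^ 2 * (g * D') from rfl] at hdvd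
  have h64 : 64 * u' ^ 2 ∣ t ^ 2 := (mul_dvd_mul_iff_right (mul_ne_zero hg0 hD'0)).mp hdvd
  have ht2 : 0 < t ^ 2 ∧ t ^ 2 ≤ 4 := by rcases ht with rfl | rfl <;> norm_num
  have hle := Int.le_of_dvd ht2.1 h64
  have hu'2 : 0 < u' ^ 2 := by positivity
  omega

/-- **`√2 ∉ K[1]` when `d_K/4` is odd** — the hypothesis `hsqrt2` of the cell `bsd-goldfeld`'s second-halving
theorems, discharged. [cite: Cox2013, §6.A Thm. 6.1] -/
theorem not_isSquare_two_ringClassField_one (hK : IsImaginaryQuadratic K) (ι : K →+* ℂ)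
    (hodd : Odd (NumberField.discr K / 4)) : ¬ IsSquare (2 : ringClassField K ι 1) := by
  simpa using not_isSquare_two_mul_ringClassField_one hK ι hodd odd_one squarefree_one

/-- **`√14 ∉ K[1]` when `d_K/4` is odd** — the hypothesis `hsqrt14` of the cell `bsd-goldfeld`'s second-halving
theorems, discharged. [cite: Cox2013, §6.A Thm. 6.1] -/
theorem not_isSquare_fourteen_ringClassField_one (hK : IsImaginaryQuadratic K) (ι : K →+* ℂ)
    (hodd : Odd (NumberField.discr K / 4)) : ¬ IsSquare (14 : ringClassField K ι 1) := by
  have h7 : Squarefree (7 : ℤ) := (Int.prime_iff_natAbs_prime.mpr (by norm_num)).irreducible.squarefree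
  simpa using not_isSquare_two_mul_ringClassField_one hK ι hodd (by decide : Odd (7 : ℤ)) h7

end Literature.NumberTheory.EllipticCurves

end
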